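import Summits.BirchSwinnertonDyer.Rank1Residual.X10.CasselsTatePairingCertificate
import HarnessLib

/-!
# The Cassels–Tate GRAM-MATRIX certificate: `⟨·,·⟩` non-degenerate on `Ш[p]` ⇒ `Ш[p²] = Ш[p]`
# — discharging the binder `∀ x : Ш, p² • x = 0 → p • x = 0` of `CasselsTatePairingCertificate.lean`
# by a kernel theorem about ANY bi-additive pairing (cell `b2b-bsdres`, unit `b2b-bsdres-x10`, gen 10)

HONEST FRAMING (run/shared/lean/b2b/bsd-rank1-residual/, verbatim in every file): the goal of the
cell is to DELETE the COMBINATION-SHAPED residual classes of the Birch–Swinnerton-Dyer formula for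
ALL analytic-rank `≤ 1` elliptic curves over `ℚ` — "full BSD formula for every rank `≤ 1` curve in
class `C`" assembled STRICTLY from published theorems — so that the rank-`≤ 1` remainder becomes
exactly the CONSTRUCTION-SHAPED classes, which are TYPED (missing-input `Prop`s), NOT attempted.
This is not "finishing BSD". Theorems only (no definition, no new named fact); nothing is booked
here; no class label changes (X10b stays CONSTRUCTION-SHAPED, referee R82.3 / R106.7). Per pair.

**What this file adds** (referee R106.7 (iv): "the binder of p213922 discharged only by a kernel
object or a cited fact"). `CasselsTatePairingCertificate.lean` (p213922) consumes the CTP-on-Sel^(3)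
instrument through the binder `∀ x : Ш(E/ℚ), p² • x = 0 → p • x = 0`. The instrument's actual
OUTPUT (HOME/b2b-bsdres-x10/g8/ctp-sel3/FORMAT.md C6, schema `ctp-sel3/1.1`) is a GRAM MATRIX
`G = (⟨x_i, x_k⟩)_{i,k}` of the Cassels–Tate pairing on an `𝔽_p`-basis `x_1, …, x_d` of
`S^(p)(E/ℚ) ≅ Ш(E/ℚ)[p]` (rank `0`, `E(ℚ)[p] = 0`), computed by Fisher–Newton's formula
(IJNT 10 (2014), Thm. 1.3) and re-computed by the independent verifier B. This file proves, as
KERNEL theorems about an ARBITRARY bi-additive pairing `B : A × A → Q` on an ARBITRARY additive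
commutative group (no alternation, no finiteness, no structure theorem, no Cassels–Tate input):
* `sq_nsmul_stable_of_nondegenerate` — if `B` restricted to `A[n] × A[n]` has trivial left kernel
  then `A[n²] = A[n]`: for `n² • x = 0` the element `ξ = n • x ∈ A[n]` pairs to zero with all of
  `A[n]` (`B (n • x) y = B x (n • y) = 0`), so `ξ = 0`. ONE LINE of bilinearity — this is the whole
  content of "kernel of `⟨·,·⟩` on `S^(p)` ⊇ image of `S^(p²)`" (Cassels 1998 §1, the inclusion
  that the instrument uses; the reverse inclusion is never needed);
* `nondegenerate_of_gram`, `torsionBy_subset_span_of_card_of_gram`, `sq_nsmul_stable_of_gram` — the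
  `d = 2` Gram shape the instrument prints: `x₁, x₂ ∈ A[p]` with `B x₁ x₁ = B x₂ x₂ = 0`,
  `B x₁ x₂ ≠ 0`, `B x₂ x₁ ≠ 0` (the alternating non-zero matrix `[0 g; −g 0]`) and `#A[p] = p²`
  force `x₁, x₂` to SPAN `A[p]` (a counting argument: the `p²` combinations are distinct because
  `B x₁ x₂`, `B x₂ x₁` have additive order `p`) and `B|A[p]` to be non-degenerate, hence
  `A[p²] = A[p]`;
* `shaNoPSqTorsion_of_gram_of_card_selmerGroup` (any number field; rank `0`, `p ∤ #E(K)_tors`,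
  `#Sel^(p) = p²` — so `#Ш[p] = p²` by p213922's PROVED bijection `Sel^(p) ≅ Ш[p]`) and, over `ℚ`,
  `bsdp_of_ctpGram_of_card_selmerGroup` / `padicValNat_shaOrder_eq_two_of_ctpGram` /
  `X10.bsdp_three_rankZero_of_ctpGram_of_card_selmerThree` /
  `X10.missingInputAt_of_ctpGram_of_card_selmerThree`: Miller's `BSD(E,p)` (resp. the typed input
  of `Typed/X10.lean`) from Gross–Zagier–Kolyvagin, the `p`-descent certificate `#Sel^(p) = p²`, the
  analytic datum `ord_p #Ш_an = 2`, and a bi-additive pairing on `Ш(E/ℚ)` with the printed Gram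
  shape on two `p`-torsion classes — NOTHING ELSE (no Cassels–Tate squareness, no main conjecture,
  no Heegner index, no image hypothesis beyond `irr(3) ∈ ClassX10` for `3 ∤ #E(ℚ)_tors`).
So the per-pair binder left to the certificate is exactly: "the Cassels–Tate pairing `⟨·,·⟩` on
`Ш(E/ℚ)` (Cassels 1962 / bsd.S18 = tree `WeierstrassCurve.exists_casselsTate_pairing`, a
bi-additive map `Ш × Ш → ℚ/ℤ`) has Gram matrix `[0 g; g′ 0]`, `g, g′ ≠ 0`, on the images
`x₁, x₂ ∈ Ш[3]` of the certified Selmer basis `η₁, η₂`" — which is what the ctp-sel3 document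
states and verifier B recomputes, the identification "printed matrix = Gram matrix of `⟨·,·⟩`"
being the CITED theorem [FisherNewton2014, Thm. 1.3] (C109 in the cell's CITED-FACTS) together
with the compatibility of Cassels' `S^(p)`-pairing with `⟨·,·⟩` on `Ш[p]` [Cassels1998, §1]. For a
forced-zero control (rank `2`, `Sel^(3) = E(ℚ)/3E(ℚ)`) nothing is inferred, as the charter says.
Census instance: `340186p1 @ 3` (`G = [0 −1; 1 0]`, implementation A, three reproductions;
verifier B unread; R106.7 (i)–(iii) pending — NOT booked). Per curve; NOT a class theorem.

References: Cassels 1998 §1 [Cassels1998]; Fisher–Newton 2014 Thm. 1.3, eqs. (1)–(2)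
[FisherNewton2014]; Silverman AEC X.4.14 (bsd.S18) and X.4.2 [SilvermanAEC2009]; Miller 2011
Def. 1.1 [Miller2011LMS]; companion `Typed/X5DescentPairing.lean` (the `p = 2` analogue
`stable_four_of_pairing_bits`, unit sha-1); cell files X10-AUDIT.md §13–§15,
HOME/b2b-bsdres-x10/g8/ctp-sel3/{CHARTER,FORMAT}.md, referee R106.7.
-/

noncomputable section

open scoped Classical

open WeierstrassCurve Literature.NumberTheory.EllipticCurves
  Literature.NumberTheory.EllipticCurves.Rank1Residual
  Literature.NumberTheory.EllipticCurves.Rank1Residual.Typed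

namespace Summit.BirchSwinnertonDyer.Rank1Residual.X10

/-! ### §1 Algebra: a pairing non-degenerate on `A[n]` stabilises the `n`-power torsion at `A[n]` -/

section Algebra

variable {A : Type*} [AddCommGroup A] {Q : Type*} [AddCommGroup Q] (B : A →+ A →+ Q)

/-- **Non-degeneracy on `A[n]` ⇒ `A[n²] = A[n]`, for ANY bi-additive pairing.** If every non-zero
`ξ ∈ A[n]` pairs non-trivially with some `y ∈ A[n]`, then `n² • x = 0 ⇒ n • x = 0`: the element
`ξ := n • x ∈ A[n]` satisfies `B ξ y = B x (n • y) = 0` for all `y ∈ A[n]`. This is the inclusion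
"image of `S^(n²)` ⊆ kernel of the pairing on `S^(n)`" of Cassels, used contrapositively; pure
bilinearity. [cite: Cassels1998, §1] [cite: FisherNewton2014, eqs. (1)–(2)] -/
theorem sq_nsmul_stable_of_nondegenerate {n : ℕ}
    (hnd : ∀ ξ : A, n • ξ = 0 → ξ ≠ 0 → ∃ y : A, n • y = 0 ∧ B ξ y ≠ 0) :
    ∀ x : A, n ^ 2 • x = 0 → n • x = 0 := by
  intro x hx
  by_contra hne
  have hξ : n • (n • x) = 0 := by rw [← mul_smul, ← pow_two]; exact hx
  obtain ⟨y, hy, hB⟩ := hnd (n • x) hξ hne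
  apply hB
  rw [map_nsmul, AddMonoidHom.nsmul_apply, ← map_nsmul, hy, map_zero]

/-- A non-zero value `B x y` with `p • x = 0` (`p` prime) has additive order exactly `p`. [folklore] -/
theorem addOrderOf_apply_eq_of_nsmul_eq_zero {p : ℕ} [hp : Fact p.Prime] {x y : A} (hx : p • x = 0)
    (hne : B x y ≠ 0) : addOrderOf (B x y) = p :=
  addOrderOf_eq_prime
    (by rw [← AddMonoidHom.nsmul_apply, ← map_nsmul, hx, map_zero, AddMonoidHom.zero_apply]) hne

/-- **The `2 × 2` Gram shape ⇒ non-degeneracy on `A[p]`.** If `x₁, x₂ ∈ A[p]` span `A[p]` and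
`B x₁ x₁ = B x₂ x₂ = 0`, `B x₁ x₂ ≠ 0`, `B x₂ x₁ ≠ 0` (the alternating non-zero Gram matrix the
CTP instrument prints for `dim Sel^(p) = 2`), then every non-zero `ξ = a • x₁ + b • x₂ ∈ A[p]`
pairs non-trivially with `x₂` (value `a • B x₁ x₂`) or with `x₁` (value `b • B x₂ x₁`): both vanish
only if `p ∣ a` and `p ∣ b`, i.e. `ξ = 0`. Elementary. [cite: FisherNewton2014, §4 (the CTP table)] -/
theorem nondegenerate_of_gram {p : ℕ} [Fact p.Prime] {x₁ x₂ : A}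
    (hx₁ : p • x₁ = 0) (hx₂ : p • x₂ = 0)
    (hspan : ∀ ξ : A, p • ξ = 0 → ∃ a b : ℕ, ξ = a • x₁ + b • x₂)
    (h₁₁ : B x₁ x₁ = 0) (h₂₂ : B x₂ x₂ = 0) (h₁₂ : B x₁ x₂ ≠ 0) (h₂₁ : B x₂ x₁ ≠ 0) :
    ∀ ξ : A, p • ξ = 0 → ξ ≠ 0 → ∃ y : A, p • y = 0 ∧ B ξ y ≠ 0 := by
  intro ξ hξ hne
  obtain ⟨a, b, rfl⟩ := hspan ξ hξ
  have e₂ : B (a • x₁ + b • x₂) x₂ = a • B x₁ x₂ := by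
    rw [map_add, map_nsmul, map_nsmul, AddMonoidHom.add_apply, AddMonoidHom.nsmul_apply,
      AddMonoidHom.nsmul_apply, h₂₂, smul_zero, add_zero]
  have e₁ : B (a • x₁ + b • x₂) x₁ = b • B x₂ x₁ := by
    rw [map_add, map_nsmul, map_nsmul, AddMonoidHom.add_apply, AddMonoidHom.nsmul_apply,
      AddMonoidHom.nsmul_apply, h₁₁, smul_zero, zero_add]
  by_cases ha : a • B x₁ x₂ = 0
  · by_cases hb : b • B x₂ x₁ = 0
    · exfalso
      have hpa : p ∣ a := by
        rw [← addOrderOf_apply_eq_of_nsmul_eq_zero B hx₁ h₁₂]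
        exact addOrderOf_dvd_of_nsmul_eq_zero ha
      have hpb : p ∣ b := by
        rw [← addOrderOf_apply_eq_of_nsmul_eq_zero B hx₂ h₂₁]
        exact addOrderOf_dvd_of_nsmul_eq_zero hb
      obtain ⟨a', rfl⟩ := hpa
      obtain ⟨b', rfl⟩ := hpb
      apply hne
      rw [mul_comm p a', mul_smul, hx₁, mul_comm p b', mul_smul, hx₂, smul_zero, smul_zero,
        add_zero]
    · exact ⟨x₁, hx₁, by rwa [e₁]⟩
  · exact ⟨x₂, hx₂, by rwa [e₂]⟩

/-- **The Gram shape plus `#A[p] = p²` ⇒ `x₁, x₂` span `A[p]`.** The `p²` combinations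
`a • x₁ + b • x₂` (`0 ≤ a, b < p`) are pairwise distinct — pair a coincidence with `x₂` and with
`x₁`: `a • B x₁ x₂ = a' • B x₁ x₂` and `b • B x₂ x₁ = b' • B x₂ x₁` with `B x₁ x₂`, `B x₂ x₁` of
order `p` give `a = a'`, `b = b'` — so by counting they exhaust `A[p]`. No structure theorem, no
vector-space language. Elementary. [folklore] -/
theorem torsionBy_subset_span_of_card_of_gram {p : ℕ} [hp : Fact p.Prime] {x₁ x₂ : A}
    (hx₁ : p • x₁ = 0) (hx₂ : p • x₂ = 0)
    (h₁₁ : B x₁ x₁ = 0) (h₂₂ : B x₂ x₂ = 0) (h₁₂ : B x₁ x₂ ≠ 0) (h₂₁ : B x₂ x₁ ≠ 0)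
    (hcard : Nat.card (AddSubgroup.torsionBy A p) = p ^ 2) :
    ∀ ξ : A, p • ξ = 0 → ∃ a b : ℕ, ξ = a • x₁ + b • x₂ := by
  have hmem : ∀ ab : Fin p × Fin p,
      (ab.1 : ℕ) • x₁ + (ab.2 : ℕ) • x₂ ∈ AddSubgroup.torsionBy A p := fun ab =>
    AddSubgroup.torsionBy.nsmul_iff.mpr (by
      rw [smul_add, smul_smul, smul_smul, mul_comm p (ab.1 : ℕ), mul_comm p (ab.2 : ℕ), mul_smul,
        mul_smul, hx₁, hx₂, smul_zero, smul_zero, add_zero])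
  set f : Fin p × Fin p → AddSubgroup.torsionBy A p := fun ab =>
    ⟨(ab.1 : ℕ) • x₁ + (ab.2 : ℕ) • x₂, hmem ab⟩ with hf
  have hinj : Function.Injective f := by
    rintro ⟨a, b⟩ ⟨a', b'⟩ h
    have h' : (a : ℕ) • x₁ + (b : ℕ) • x₂ = (a' : ℕ) • x₁ + (b' : ℕ) • x₂ := by
      have h0 := congrArg Subtype.val h
      change (a : ℕ) • x₁ + (b : ℕ) • x₂ = (a' : ℕ) • x₁ + (b' : ℕ) • x₂ at h0
      exact h0
    have ha : (a : ℕ) • B x₁ x₂ = (a' : ℕ) • B x₁ x₂ := by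
      have := congrArg (fun z => B z x₂) h'
      simpa only [map_add, map_nsmul, AddMonoidHom.add_apply, AddMonoidHom.nsmul_apply, h₂₂,
        smul_zero, add_zero] using this
    have hb : (b : ℕ) • B x₂ x₁ = (b' : ℕ) • B x₂ x₁ := by
      have := congrArg (fun z => B z x₁) h'
      simpa only [map_add, map_nsmul, AddMonoidHom.add_apply, AddMonoidHom.nsmul_apply, h₁₁,
        smul_zero, zero_add] using this
    rw [nsmul_eq_nsmul_iff_modEq, addOrderOf_apply_eq_of_nsmul_eq_zero B hx₁ h₁₂] at ha
    rw [nsmul_eq_nsmul_iff_modEq, addOrderOf_apply_eq_of_nsmul_eq_zero B hx₂ h₂₁] at hb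
    exact Prod.ext (Fin.ext (Nat.ModEq.eq_of_lt_of_lt ha a.2 a'.2))
      (Fin.ext (Nat.ModEq.eq_of_lt_of_lt hb b.2 b'.2))
  haveI : Finite (AddSubgroup.torsionBy A p) :=
    Nat.finite_of_card_ne_zero (by rw [hcard]; exact pow_ne_zero _ hp.out.ne_zero)
  have hbij : Function.Bijective f := hinj.bijective_of_nat_card_le (by
    rw [hcard, Nat.card_prod, Nat.card_fin, pow_two])
  intro ξ hξ
  obtain ⟨⟨a, b⟩, hab⟩ := hbij.2 ⟨ξ, AddSubgroup.torsionBy.nsmul_iff.mpr hξ⟩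
  refine ⟨a, b, ?_⟩
  have h0 := congrArg Subtype.val hab
  change (a : ℕ) • x₁ + (b : ℕ) • x₂ = ξ at h0
  exact h0.symm

/-- **Gram certificate ⇒ `A[p²] = A[p]`.** Composition of `torsionBy_subset_span_of_card_of_gram`,
`nondegenerate_of_gram` and `sq_nsmul_stable_of_nondegenerate`: two `p`-torsion elements with the
alternating non-zero Gram shape under ANY bi-additive pairing, in a group with `#A[p] = p²`, force
`∀ x, p² • x = 0 → p • x = 0`. This is the kernel object that discharges the binder of
`card_primaryComponent_sha_eq_of_sq_of_card_selmerGroup` (p213922) from the instrument's printed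
matrix. [cite: Cassels1998, §1] [cite: FisherNewton2014, Thm. 1.3 and eqs. (1)–(2)] -/
theorem sq_nsmul_stable_of_gram {p : ℕ} [Fact p.Prime] {x₁ x₂ : A}
    (hx₁ : p • x₁ = 0) (hx₂ : p • x₂ = 0)
    (h₁₁ : B x₁ x₁ = 0) (h₂₂ : B x₂ x₂ = 0) (h₁₂ : B x₁ x₂ ≠ 0) (h₂₁ : B x₂ x₁ ≠ 0)
    (hcard : Nat.card (AddSubgroup.torsionBy A p) = p ^ 2) :
    ∀ x : A, p ^ 2 • x = 0 → p • x = 0 :=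
  sq_nsmul_stable_of_nondegenerate B
    (nondegenerate_of_gram B hx₁ hx₂
      (torsionBy_subset_span_of_card_of_gram B hx₁ hx₂ h₁₁ h₂₂ h₁₂ h₂₁ hcard) h₁₁ h₂₂ h₁₂ h₂₁)

end Algebra

/-! ### §2 Rank `0` over a number field: the Gram certificate on `Ш(E/K)` -/

section General

variable {K : Type*} [Field K] [NumberField K] (W : WeierstrassCurve K) [W.IsElliptic]

/-- **`Ш(E/K)[p²] = Ш(E/K)[p]` from the two finite certificates.** Rank `0` and `p ∤ #E(K)_tors`
give `#Ш(E/K)[p] = #Sel^(p)(E/K)` (p213922's PROVED bijection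
`card_sha_inf_torsionBy_eq_card_selmerGroup_of_rankZero`); with the descent certificate
`#Sel^(p) = p²` and ANY bi-additive pairing `B` on `Ш(E/K)` whose Gram matrix on two `p`-torsion
classes `x₁, x₂` has the alternating non-zero shape, `sq_nsmul_stable_of_gram` applies. Intended
`B`: the Cassels–Tate pairing (bsd.S18), its Gram matrix computed per pair by Fisher–Newton's
formula and re-computed by verifier B. [cite: SilvermanAEC2009, Thm X.4.2(a)]
[cite: FisherNewton2014, Thm. 1.3] -/
theorem shaNoPSqTorsion_of_gram_of_card_selmerGroup (p : ℕ) [Fact p.Prime]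
    (hrank : W.mordellWeilRank = 0) (htors : ¬ p ∣ W.torsionOrder)
    (hcard : Nat.card (W.selmerGroup (p : ℤ)) = p ^ 2)
    {Q : Type*} [AddCommGroup Q] (B : W.sha →+ W.sha →+ Q) {x₁ x₂ : W.sha}
    (hx₁ : p • x₁ = 0) (hx₂ : p • x₂ = 0)
    (h₁₁ : B x₁ x₁ = 0) (h₂₂ : B x₂ x₂ = 0) (h₁₂ : B x₁ x₂ ≠ 0) (h₂₁ : B x₂ x₁ ≠ 0) :
    ∀ x : W.sha, p ^ 2 • x = 0 → p • x = 0 := by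
  have hc : Nat.card (AddSubgroup.torsionBy W.sha p) = p ^ 2 := by
    rw [card_torsionBy_coe_eq_card_inf,
      card_sha_inf_torsionBy_eq_card_selmerGroup_of_rankZero W p hrank htors, hcard]
  exact sq_nsmul_stable_of_gram B hx₁ hx₂ h₁₁ h₂₂ h₁₂ h₂₁ hc

/-- **Hence `#Ш(E/K)[p^∞] = p²` EXACTLY** on such a pair (no finiteness of `Ш` assumed).
[cite: SilvermanAEC2009, Thm X.4.2(a)] -/
theorem card_primaryComponent_sha_eq_sq_of_gram (p : ℕ) [Fact p.Prime]
    (hrank : W.mordellWeilRank = 0) (htors : ¬ p ∣ W.torsionOrder)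
    (hcard : Nat.card (W.selmerGroup (p : ℤ)) = p ^ 2)
    {Q : Type*} [AddCommGroup Q] (B : W.sha →+ W.sha →+ Q) {x₁ x₂ : W.sha}
    (hx₁ : p • x₁ = 0) (hx₂ : p • x₂ = 0)
    (h₁₁ : B x₁ x₁ = 0) (h₂₂ : B x₂ x₂ = 0) (h₁₂ : B x₁ x₂ ≠ 0) (h₂₁ : B x₂ x₁ ≠ 0) :
    Nat.card (AddCommGroup.primaryComponent W.sha p) = p ^ 2 :=
  card_primaryComponent_sha_eq_of_sq_of_card_selmerGroup W p hrank htors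
    (shaNoPSqTorsion_of_gram_of_card_selmerGroup W p hrank htors hcard B hx₁ hx₂ h₁₁ h₂₂ h₁₂ h₂₁)
    hcard

end General

/-! ### §3 Over `ℚ`: Miller's `BSD(E,p)` from GZK + `#Sel^(p) = p²` + the Gram certificate -/

section OverQ

variable (W : WeierstrassCurve ℚ) [W.IsElliptic] (p : ℕ) [Fact p.Prime]

/-- **`BSD(E,p)` at a rank-`0` pair from the `p`-descent certificate and the CTP Gram matrix.**
`E/ℚ` of analytic rank `0` (Gross–Zagier–Kolyvagin `hGZK` = bsd.S17), `p ∤ #E(ℚ)_tors`,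
`#Sel^(p)(E/ℚ) = p²` (two descent engines), a bi-additive pairing on `Ш(E/ℚ)` with Gram shape
`[0 g; g′ 0]`, `g, g′ ≠ 0`, on two `p`-torsion classes (the ctp-sel3 certificate, `G` alternating of
rank `2`), and `ord_p #Ш_an = 2` ⇒ Miller's `BSD(E,p)`. Class-free, reduction-type-free; per curve.
[cite: Miller2011LMS, §1 and Def. 1.1] [cite: FisherNewton2014, Thm. 1.3 and eqs. (1)–(2)]
[cite: SilvermanAEC2009, Thm X.4.2(a)] -/
theorem bsdp_of_ctpGram_of_card_selmerGroup
    (hGZK : rank_eq_analyticRank_of_analyticRank_le_one) (hr : W.analyticRank = 0)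
    (htors : ¬ p ∣ W.torsionOrder) (hcard : Nat.card (W.selmerGroup (p : ℤ)) = p ^ 2)
    {Q : Type*} [AddCommGroup Q] (B : W.sha →+ W.sha →+ Q) {x₁ x₂ : W.sha}
    (hx₁ : p • x₁ = 0) (hx₂ : p • x₂ = 0)
    (h₁₁ : B x₁ x₁ = 0) (h₂₂ : B x₂ x₂ = 0) (h₁₂ : B x₁ x₂ ≠ 0) (h₂₁ : B x₂ x₁ ≠ 0)
    {q : ℚ} (hq : shaAn W = (q : ℂ)) (hv : padicValRat p q = 2) : BSDp W p := by
  have hr1 : W.analyticRank ≤ 1 := by rw [hr]; norm_num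
  have hrank : W.mordellWeilRank = 0 := by rw [(hGZK W hr1).1, hr]
  exact bsdp_of_shaNoPSqTorsion_of_card_selmerGroup W p hGZK hr htors hcard
    (shaNoPSqTorsion_of_gram_of_card_selmerGroup W p hrank htors hcard B hx₁ hx₂ h₁₁ h₂₂ h₁₂ h₂₁)
    hq (by exact_mod_cast hv)

/-- **The exact `p`-part on such a pair: `ord_p #Ш(E/ℚ) = 2`.** [cite: SilvermanAEC2009, Thm X.4.2(a)] -/
theorem padicValNat_shaOrder_eq_two_of_ctpGram
    (hGZK : rank_eq_analyticRank_of_analyticRank_le_one) (hr : W.analyticRank = 0)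
    (htors : ¬ p ∣ W.torsionOrder) (hcard : Nat.card (W.selmerGroup (p : ℤ)) = p ^ 2)
    {Q : Type*} [AddCommGroup Q] (B : W.sha →+ W.sha →+ Q) {x₁ x₂ : W.sha}
    (hx₁ : p • x₁ = 0) (hx₂ : p • x₂ = 0)
    (h₁₁ : B x₁ x₁ = 0) (h₂₂ : B x₂ x₂ = 0) (h₁₂ : B x₁ x₂ ≠ 0) (h₂₁ : B x₂ x₁ ≠ 0) :
    padicValNat p W.shaOrder = 2 := by
  have hr1 : W.analyticRank ≤ 1 := by rw [hr]; norm_num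
  have hrank : W.mordellWeilRank = 0 := by rw [(hGZK W hr1).1, hr]
  exact padicValNat_shaOrder_eq_of_shaNoPSqTorsion_of_card_selmerGroup W p hGZK hr htors hcard
    (shaNoPSqTorsion_of_gram_of_card_selmerGroup W p hrank htors hcard B hx₁ hx₂ h₁₁ h₂₂ h₁₂ h₂₁)

/-- **`BSD(E,p)` from a non-degeneracy certificate of general dimension** (`#Sel^(p) = p^m`, any
`m`; the instrument's `d > 2` population, e.g. octic targets): GZK, `p ∤ #E(ℚ)_tors`, a bi-additive
pairing on `Ш(E/ℚ)` non-degenerate on `Ш[p]`, `ord_p #Ш_an = m` ⇒ `BSD(E,p)`. Per curve.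
[cite: Miller2011LMS, §1 and Def. 1.1] [cite: Cassels1998, §1] -/
theorem bsdp_of_ctpNondegenerate_of_card_selmerGroup
    (hGZK : rank_eq_analyticRank_of_analyticRank_le_one) (hr : W.analyticRank = 0)
    (htors : ¬ p ∣ W.torsionOrder) {m : ℕ} (hcard : Nat.card (W.selmerGroup (p : ℤ)) = p ^ m)
    {Q : Type*} [AddCommGroup Q] (B : W.sha →+ W.sha →+ Q)
    (hnd : ∀ ξ : W.sha, p • ξ = 0 → ξ ≠ 0 → ∃ y : W.sha, p • y = 0 ∧ B ξ y ≠ 0)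
    {q : ℚ} (hq : shaAn W = (q : ℂ)) (hv : padicValRat p q = m) : BSDp W p :=
  bsdp_of_shaNoPSqTorsion_of_card_selmerGroup W p hGZK hr htors hcard
    (sq_nsmul_stable_of_nondegenerate B hnd) hq hv

end OverQ

/-! ### §4 Class X10 at `p = 3`, rank `0`: the booking shape for a ctp-sel3 certificate -/

section X10

variable (W : WeierstrassCurve ℚ) [W.IsElliptic] [W.IsGloballyMinimal]

/-- **X10 ∧ `r = 0`: `BSD(E,3)` from GZK + `dim Sel^(3) = 2` + the CTP Gram matrix.** At a pair
with `ClassX10 W 3` (used only through `irr(3) ⇒ 3 ∤ #E(ℚ)_tors`, Mazur), analytic rank `0`,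
`#Sel^(3)(E/ℚ) = 9` (two `3`-descent engines), a bi-additive pairing on `Ш(E/ℚ)` whose Gram matrix
on two `3`-torsion classes is `[0 g; g′ 0]` with `g, g′ ≠ 0` (the ctp-sel3/1.1 certificate: `G`
alternating of rank `2`, implementation A + verifier B), and `ord_3 #Ш_an = 2`. Census instance
awaiting R106.7 (i)–(iii): `340186p1` (`G = [0 −1; 1 0]`). Per curve; NOT a class theorem; the lane
books on the referee's signature. [cite: Miller2011LMS, §1 and Def. 1.1]
[cite: FisherNewton2014, Thm. 1.3] [cite: SilvermanAEC2009, Thm X.4.2(a)] -/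
theorem bsdp_three_rankZero_of_ctpGram_of_card_selmerThree
    (hGZK : rank_eq_analyticRank_of_analyticRank_le_one) (hX : ClassX10 W 3)
    (hr : W.analyticRank = 0) (hcard : Nat.card (W.selmerGroup (3 : ℤ)) = 9)
    {Q : Type*} [AddCommGroup Q] (B : W.sha →+ W.sha →+ Q) {x₁ x₂ : W.sha}
    (hx₁ : 3 • x₁ = 0) (hx₂ : 3 • x₂ = 0)
    (h₁₁ : B x₁ x₁ = 0) (h₂₂ : B x₂ x₂ = 0) (h₁₂ : B x₁ x₂ ≠ 0) (h₂₁ : B x₂ x₁ ≠ 0)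
    {q : ℚ} (hq : shaAn W = (q : ℂ)) (hv : padicValRat 3 q = 2) : BSDp W 3 :=
  bsdp_of_ctpGram_of_card_selmerGroup W 3 hGZK hr (not_three_dvd_torsionOrder_of_classX10 W hX)
    (by rw [show (3 : ℕ) ^ 2 = 9 by norm_num]; exact_mod_cast hcard) B hx₁ hx₂ h₁₁ h₂₂ h₁₂ h₂₁ hq hv

/-- The exact `3`-part on such an X10 pair: `ord_3 #Ш(E/ℚ) = 2`, i.e. `#Ш(E/ℚ)[3^∞] = 9`.
[cite: SilvermanAEC2009, Thm X.4.2(a)] -/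
theorem padicValNat_shaOrder_three_eq_two_of_ctpGram
    (hGZK : rank_eq_analyticRank_of_analyticRank_le_one) (hX : ClassX10 W 3)
    (hr : W.analyticRank = 0) (hcard : Nat.card (W.selmerGroup (3 : ℤ)) = 9)
    {Q : Type*} [AddCommGroup Q] (B : W.sha →+ W.sha →+ Q) {x₁ x₂ : W.sha}
    (hx₁ : 3 • x₁ = 0) (hx₂ : 3 • x₂ = 0)
    (h₁₁ : B x₁ x₁ = 0) (h₂₂ : B x₂ x₂ = 0) (h₁₂ : B x₁ x₂ ≠ 0) (h₂₁ : B x₂ x₁ ≠ 0) :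
    padicValNat 3 W.shaOrder = 2 :=
  padicValNat_shaOrder_eq_two_of_ctpGram W 3 hGZK hr (not_three_dvd_torsionOrder_of_classX10 W hX)
    (by rw [show (3 : ℕ) ^ 2 = 9 by norm_num]; exact_mod_cast hcard) B hx₁ hx₂ h₁₁ h₂₂ h₁₂ h₂₁

/-- **Discharging the typed missing input of `Typed/X10.lean`** at such a pair from the two
certificates in their PRINTED shape (`#Sel^(3) = 9`, Gram matrix). Bookkeeping.
[cite: Miller2011LMS, Def. 1.1] -/
theorem missingInputAt_of_ctpGram_of_card_selmerThree
    (hGZK : rank_eq_analyticRank_of_analyticRank_le_one) (hX : ClassX10 W 3)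
    (hr : W.analyticRank = 0) (hcard : Nat.card (W.selmerGroup (3 : ℤ)) = 9)
    {Q : Type*} [AddCommGroup Q] (B : W.sha →+ W.sha →+ Q) {x₁ x₂ : W.sha}
    (hx₁ : 3 • x₁ = 0) (hx₂ : 3 • x₂ = 0)
    (h₁₁ : B x₁ x₁ = 0) (h₂₂ : B x₂ x₂ = 0) (h₁₂ : B x₁ x₂ ≠ 0) (h₂₁ : B x₂ x₁ ≠ 0)
    {q : ℚ} (hq : shaAn W = (q : ℂ)) (hv : padicValRat 3 q = 2) : X10.MissingInputAt W := fun _ =>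
  haveI : Finite W.sha := (hGZK W hX.analyticRank_le_one).2
  missingPPartAt_of_bsdp W 3
    (bsdp_three_rankZero_of_ctpGram_of_card_selmerThree W hGZK hX hr hcard B hx₁ hx₂ h₁₁ h₂₂ h₁₂
      h₂₁ hq hv)

end X10

end Summit.BirchSwinnertonDyer.Rank1Residual.X10

end
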